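import Literature.NumberTheory.GelbartRogawski1991.LocalSplittingL2Metaplectic
import Literature.RepresentationTheory.HeisenbergGroup.StoneVonNeumannUniqueness
import HarnessLib

/-!
# At a finite place, every irreducible unitary representation of `H(𝕎_v)` with central character `ψ_v` is unitarily
# equivalent to the tree's `ρ_{ψ_v}` on `L²(F_vᴺ)` (Stone–von Neumann uniqueness for `localSchrodingerL2`)

Topic `NumberTheory/GelbartRogawski1991`; namespace `Literature.NumberTheory.GelbartRogawski1991.UnitaryDualPair.LocalSplitting`.
KERNEL ONLY: theorems; no definition, no named fact, no record, no `sorry`.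

[GelbartRogawski1991, §3.1 p. 454 L19–21]: "For each non-trivial character `ψ`, let `ρ_ψ` be an irreducible unitary
representation of `H_𝐀(W)` with central character `ψ` (`ρ_ψ` is unique up to isomorphism)."  The tree's
`Prop311AsPrinted` (rendering R2/R4) accordingly quantifies over EVERY complex Hilbert space `S` with such a `ρ`.
`LocalSplittingL2Metaplectic.lean` built ONE such representation at each finite place `v` — `localSchrodingerL2 F N T v μ'`
on `L²(F_vᴺ, μ'ᴺ)`, unitary, central character `ψ_v = adeleAddCharAt F v`, irreducible — and recorded as missing "the
UNIQUENESS half of Stone–von Neumann (not in the tree)" needed to reach an arbitrary model.  This file supplies it at the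
finite place `v`: **`exists_linearIsometryEquiv_localSchrodingerL2`** — for `T ∈ GL_N(F)` and any representation `ρ` of
`H(𝕎_v) = Heisenberg (polar (localPairing F N T v))` on a complex Hilbert space `S ≠ 0` by isometries, with continuous
orbit maps `w ↦ ρ(w, 0) f`, central character `ψ_v` and no closed invariant subspace other than `⊥`, `⊤`, there is a
unitary `U : S ≃ₗᵢ[ℂ] L²(F_vᴺ, μ'ᴺ)` with `U (ρ h f) = ρ_{ψ_v}(h) (U f)` — the tree's
`HeisenbergGroup.exists_linearIsometryEquiv_schrodingerL2` (`StoneVonNeumannUniqueness.lean`) at `F_v`, `𝕋_v`, `ψ_v`.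

So "the space of `ρ_ψ`" of the printed text may, at a finite place, be taken to be the tree's `L²(F_vᴺ)` without loss:
any other local model is conjugate to it by a unitary intertwiner `U`, along which the groups of pairs `Mp_v(W)` and the
local splittings of `LocalSplittingL2Metaplectic.lean` / `LocalMetaplecticL2CentralExtension.lean` transport (the tree's
`Weil1964.MpPsi.transport` at `θ = id`, `A = U`: `(g, M) ↦ (g, U M U⁻¹)`).  The GLOBAL (adelic) uniqueness and the
archimedean places are not treated.  Nothing of [GelbartRogawski1991] is asserted.

## References
* [GelbartRogawski1991] S. Gelbart, J. Rogawski, Invent. Math. 105 (1991), §3.1 p. 454 L19–21.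
* [MoeglinVignerasWaldspurger1987] C. Mœglin, M.-F. Vignéras, J.-L. Waldspurger, LNM 1291 (1987), Chap. 2 I.2 (Théorème de
  Stone–von Neumann).
-/

set_option autoImplicit false

noncomputable section

open NumberField IsDedekindDomain _root_.MeasureTheory Matrix
open Literature.RepresentationTheory.HeisenbergGroup
open Literature.NumberTheory.Automorphic Literature.NumberTheory.Weil1964
open Literature.NumberTheory.GaloisRepresentations Literature.RepresentationTheory.HarrisKudlaSweet1996
open Literature.NumberTheory.GaloisRepresentations.IsNonarchimedeanLocalField

namespace Literature.NumberTheory.GelbartRogawski1991.UnitaryDualPair.LocalSplitting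

variable (F : Type) [Field F] [NumberField F] (N : ℕ) (T : Matrix (Fin N) (Fin N) F) (v : HeightOneSpectrum (𝓞 F))
  [MeasurableSpace (v.adicCompletion F)] [BorelSpace (v.adicCompletion F)]
  (μ' : Measure (v.adicCompletion F)) [μ'.IsAddHaarMeasure]

/-- **Stone–von Neumann uniqueness at a finite place: "`ρ_ψ` is unique up to isomorphism".**  `T ∈ GL_N(F)`; `S` a complex
Hilbert space, `S ≠ 0`, with a representation `ρ` of `H(𝕎_v)` by linear isometries whose orbit maps `w ↦ ρ(w, 0) f` are
continuous, whose centre acts by `ψ_v`, and whose only closed invariant subspaces are `⊥`, `⊤`.  Then there is a unitary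
`U : S ≃ₗᵢ[ℂ] L²(F_vᴺ, μ'ᴺ)` intertwining `ρ` with the tree's `ρ_{ψ_v} = localSchrodingerL2 F N T v μ'`.
[cite: GelbartRogawski1991, §3.1 p. 454 L19–21] [cite: MoeglinVignerasWaldspurger1987, Chap. 2 I.2] -/
theorem exists_linearIsometryEquiv_localSchrodingerL2 (hTd : IsUnit T.det)
    {S : Type*} [NormedAddCommGroup S] [InnerProductSpace ℂ S] [CompleteSpace S] [Nontrivial S]
    (ρ : Representation ℂ (Heisenberg (polar (localPairing F N T v))) S)
    (hρu : ∀ (h : Heisenberg (polar (localPairing F N T v))) (f : S), ‖ρ h f‖ = ‖f‖)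
    (hρc : ∀ f : S, Continuous fun w : (Fin N → v.adicCompletion F) × (Fin N → v.adicCompletion F) => ρ ⟨w, 0⟩ f)
    (hρz : ∀ (t : v.adicCompletion F) (f : S),
      ρ (Heisenberg.ofCenter (polar (localPairing F N T v)) (Multiplicative.ofAdd t)) f =
        ((adeleAddCharAt F v t : Circle) : ℂ) • f)
    (hρi : ∀ K : Submodule ℂ S, IsClosed (K : Set S) →
      (∀ (h : Heisenberg (polar (localPairing F N T v))), ∀ f ∈ K, ρ h f ∈ K) → K = ⊥ ∨ K = ⊤) :
    ∃ U : S ≃ₗᵢ[ℂ] Lp ℂ 2 (Measure.pi fun _ : Fin N => μ'),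
      ∀ (h : Heisenberg (polar (localPairing F N T v))) (f : S), U (ρ h f) = localSchrodingerL2 F N T v μ' h (U f) := by
  haveI := secondCountableTopology_adicCompletion F v
  haveI : ProperSpace (v.adicCompletion F) := properSpace_adicCompletion F v
  have hdet : IsUnit (localGram F N T v).det := by
    have h := hTd.map (algebraMap F (v.adicCompletion F))
    rwa [RingHom.map_det, RingHom.mapMatrix_apply] at h
  exact exists_linearIsometryEquiv_schrodingerL2 (localGram F N T v) (adeleAddCharAt F v)
    (isLocallyConstant_of_isContinuousNontrivial (isContinuousNontrivial_adeleAddCharAt F v))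
    (continuous_toLinearMap₂'_left (localGram F N T v)) (Measure.pi fun _ : Fin N => μ')
    (SchwartzBruhat.denseRange_toLp_adicCompletionPi F v N μ') hdet (continuous_adeleAddCharAt F v)
    (exists_adeleAddCharAt_ne_one F v) ρ hρu hρc hρz hρi

/-- the same, packaged as "any two such models are unitarily equivalent to each other" through the tree's model: for two
irreducible unitary `ψ_v`-representations `ρ₁`, `ρ₂` of `H(𝕎_v)` there is a unitary `S₁ ≃ₗᵢ[ℂ] S₂` intertwining them.
[cite: GelbartRogawski1991, §3.1 p. 454 L19–21] [cite: MoeglinVignerasWaldspurger1987, Chap. 2 I.2] -/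
theorem exists_linearIsometryEquiv_of_irreducible_unitary (hTd : IsUnit T.det)
    {S₁ : Type*} [NormedAddCommGroup S₁] [InnerProductSpace ℂ S₁] [CompleteSpace S₁] [Nontrivial S₁]
    {S₂ : Type*} [NormedAddCommGroup S₂] [InnerProductSpace ℂ S₂] [CompleteSpace S₂] [Nontrivial S₂]
    (ρ₁ : Representation ℂ (Heisenberg (polar (localPairing F N T v))) S₁)
    (ρ₂ : Representation ℂ (Heisenberg (polar (localPairing F N T v))) S₂)
    (h₁u : ∀ (h : Heisenberg (polar (localPairing F N T v))) (f : S₁), ‖ρ₁ h f‖ = ‖f‖)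
    (h₁c : ∀ f : S₁, Continuous fun w : (Fin N → v.adicCompletion F) × (Fin N → v.adicCompletion F) => ρ₁ ⟨w, 0⟩ f)
    (h₁z : ∀ (t : v.adicCompletion F) (f : S₁),
      ρ₁ (Heisenberg.ofCenter (polar (localPairing F N T v)) (Multiplicative.ofAdd t)) f =
        ((adeleAddCharAt F v t : Circle) : ℂ) • f)
    (h₁i : ∀ K : Submodule ℂ S₁, IsClosed (K : Set S₁) →
      (∀ (h : Heisenberg (polar (localPairing F N T v))), ∀ f ∈ K, ρ₁ h f ∈ K) → K = ⊥ ∨ K = ⊤)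
    (h₂u : ∀ (h : Heisenberg (polar (localPairing F N T v))) (f : S₂), ‖ρ₂ h f‖ = ‖f‖)
    (h₂c : ∀ f : S₂, Continuous fun w : (Fin N → v.adicCompletion F) × (Fin N → v.adicCompletion F) => ρ₂ ⟨w, 0⟩ f)
    (h₂z : ∀ (t : v.adicCompletion F) (f : S₂),
      ρ₂ (Heisenberg.ofCenter (polar (localPairing F N T v)) (Multiplicative.ofAdd t)) f =
        ((adeleAddCharAt F v t : Circle) : ℂ) • f)
    (h₂i : ∀ K : Submodule ℂ S₂, IsClosed (K : Set S₂) →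
      (∀ (h : Heisenberg (polar (localPairing F N T v))), ∀ f ∈ K, ρ₂ h f ∈ K) → K = ⊥ ∨ K = ⊤) :
    ∃ U : S₁ ≃ₗᵢ[ℂ] S₂, ∀ (h : Heisenberg (polar (localPairing F N T v))) (f : S₁), U (ρ₁ h f) = ρ₂ h (U f) := by
  classical
  -- any Haar measure on `F_v` will do for the comparison model `L²(F_vᴺ)`
  haveI := secondCountableTopology_adicCompletion F v
  haveI : ProperSpace (v.adicCompletion F) := properSpace_adicCompletion F v
  obtain ⟨U₁, hU₁⟩ :=
    exists_linearIsometryEquiv_localSchrodingerL2 F N T v Measure.addHaar hTd ρ₁ h₁u h₁c h₁z h₁i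
  obtain ⟨U₂, hU₂⟩ :=
    exists_linearIsometryEquiv_localSchrodingerL2 F N T v Measure.addHaar hTd ρ₂ h₂u h₂c h₂z h₂i
  refine ⟨U₁.trans U₂.symm, fun h f => ?_⟩
  rw [LinearIsometryEquiv.trans_apply, hU₁, LinearIsometryEquiv.trans_apply]
  apply U₂.injective
  rw [LinearIsometryEquiv.apply_symm_apply, hU₂, LinearIsometryEquiv.apply_symm_apply]

end Literature.NumberTheory.GelbartRogawski1991.UnitaryDualPair.LocalSplitting

end
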